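import Mathlib
import HarnessLib.Audit
import Summits.PneNP.PneNP.Theorems.PstarSliceConstancy
import Summits.PneNP.PneNP.Theorems.PstarChordBridgeTools

/-!
# Which literals does a slice pin?  The BLOCK-JOIN criterion (ROUND-24, O1; memo g27 §70; answers p3's (P1)/(P2))

FRONTIER range-avoidance ladder, rung F-N3, ROUND 24 (cell `pnp-ideate`, prover-2 memo `g27/O1-PINNING-g27.md` §70; census node
`PstarLocalGateBudgetAssembly.LocalMenuCriterionBoundGateBudget`; restricted-model proof complexity — nothing here bears on `P` versus `NP`).

By `PstarMenuRelease.terminal_release` / `PstarMenuLocality.starSum_pinned` a decoration `(s, π)` of an exact certificate `(K₀; d₁, d₂)` is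
admissible iff the literal `x_s` is CONSTANT on the slice `A = Sol(K₀) ∩ {d₁ = b₁}` (p3's "A-constant column", memo r24 §14.69–70).  The
planner asked (STATUS 2026-08-29 13:37Z) for (P1) «two-block arcs pin no single literal» kernel-side and (P2) the pinning table of theta cores
and folds.  This file answers both at once, for ANY family `K` (no cycle / theta / XOR-closed hypothesis) and any first reader
`w₁ = (C₁, G₁, b₁)` whose linear part avoids the AND variables of `K ∪ G₁` (true for path sums: `C₁` = odd XOR vertices), on typed pure
instances, under the census's PRIVACY hypothesis (every output of `K ∪ G₁` not through `s` has an AND variable occurring in no other AND slot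
of `K ∪ G₁` — in the planner's structures every `N`-edge `(σ_i, p_i)` has its private `p_i`, every dirty chord / fold its private `π`):

* a **JOIN** `(D, t)` (`IsJoin`): `D ⊆ K` together with the reader (`t = true`) or without it (`t = false`) meets every variable evenly in the
  XOR slots (`xpdeg`) plus `[t]·[w ∈ C₁]` — for an XOR-closed cycle core these are `∅`, the cycle, and (with the reader) the two ARCS of the
  chord completed by the folds; for a theta core the three cycles and the three routes.  Its VALUE is `Σ_{j ∈ D} y_j + [t]·b₁` (`joinValue`).
  A join is a ONE-BLOCK join THROUGH `s` if every member of `D` — and, when `t = true`, every fold of `G₁` — has `s` as an AND variable.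
* `true_of_block_join` — a one-block join through `s` of value `1` pins `x_s ≡ 1` on the slice (sum its equations: all AND terms carry `x_s`).
* **`exists_false_of_no_block_join`** — conversely (privacy, slice non-empty): if NO one-block join through `s` has value `1`, the slice has a
  point with `x_s = 0`.  Proof: one application of the finite Fredholm alternative (`PstarXorElimination.exists_solution_iff`) to the LINEAR
  system in (XOR values, term values) — its dependencies are exactly the one-block joins through `s` — then realise the term values through the
  private variables (shared AND variables set to `1`, `x_s := 0`).
* (companion `PstarLiteralPinningCriterion`) `exists_true_of_slice` — a literal whose partners are private is NEVER pinned to `0`; and the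
  assembled criterion **`constant_iff_block_join`**: for such literals `x_s` is A-constant iff some one-block join through `s` has value `1`,
  the constant being `1`.

READING FOR THE CENSUS (all `k`): on a cycle core `K₀` with chord `c` and folds `F₁` the only candidates are the two arcs-with-folds and the
cycle; so `σ_i` is pinned iff an arc together with ALL folds consists of `σ_i`-terms only (`⊆ {t_i, o_i}`) and has value `1` — p3's
"one-block value-1 path"; genuine two-block arcs pin nothing ((P1)); a private `π_d` is pinned iff `{d}` alone is such an arc; on a theta core
the third route and the two further cycles are the additional candidates ((P2)) — a purely combinatorial table, no slice algebra needed.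
A literal `p` private to its output is handled by `PstarSliceConstancy.literal_true_of_private_constant` (it is pinned only if its `σ` is).
-/

set_option linter.dupNamespace false -- `Summit.PneNP.PneNP.…`: summit = sub-problem name (D-0017 single-conjunct layout)

open Finset Literature.Computability.Complexity
open Summit.PneNP.PneNP.Theorems.PstarFibrePolys (bit bit_xor bit_and bit_injective)
open Summit.PneNP.PneNP.Theorems.PstarTyped (Typed)
open Summit.PneNP.PneNP.Theorems.PstarGapPeeling (eval_pure)
open Summit.PneNP.PneNP.Theorems.PstarGapOneAll (gval)
open Summit.PneNP.PneNP.Theorems.PstarGConstraint (bit_gval)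
open Summit.PneNP.PneNP.Theorems.PstarXorElimination (exists_solution_iff pairForm pairForm_apply setForm setForm_apply pdeg
  sum_pairForm_add_sum_setForm_eq_zero_iff)
open Summit.PneNP.PneNP.Theorems.PstarChordBridgeTools (xpdeg)

namespace Summit.PneNP.PneNP.Theorems.PstarLiteralPinning

variable {n m : ℕ}

/-! ## Vocabulary -/

/-- Output `j` passes THROUGH the variable `s`: `s` is one of its two AND variables. -/
def Through (I : LocalMap 4 n m) (s : Fin n) (j : Fin m) : Prop := I.vars j 2 = s ∨ I.vars j 3 = s

/-- The SLICE of the family `K` (fibre values `y`) and the first reader `w₁ = (C₁, G₁, b₁)`: `z` solves every output of `K` and puts the reader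
on target. -/
def InSlice (I : LocalMap 4 n m) (y : Fin m → Bool) (K : Finset (Fin m)) (w₁ : Finset (Fin n) × Finset (Fin m) × Bool) (z : Fin n → Bool) :
    Prop :=
  (∀ j ∈ K, I.eval z j = y j) ∧ gval I w₁.1 w₁.2.1 z = w₁.2.2

/-- `(D, t)` is a JOIN for the linear part `C₁`: every variable is met an even number of times by the XOR slots of `D` plus (if `t`) its
membership in `C₁`.  (`t = false`: `D` is an even subgraph of the XOR multigraph; `t = true`: the odd vertices of `D` are exactly `C₁`.) -/
def IsJoin (I : LocalMap 4 n m) (C₁ : Finset (Fin n)) (D : Finset (Fin m)) (t : Bool) : Prop :=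
  ∀ w : Fin n, Even (xpdeg I D w + if t = true ∧ w ∈ C₁ then 1 else 0)

/-- The VALUE of the join `(D, t)`: `Σ_{j ∈ D} y_j + [t]·b₁` in `𝔽₂`. -/
def joinValue (y : Fin m → Bool) (b₁ : Bool) (D : Finset (Fin m)) (t : Bool) : ZMod 2 :=
  ∑ j ∈ D, bit (y j) + if t = true then bit b₁ else 0

variable {I : LocalMap 4 n m} {y : Fin m → Bool} {K : Finset (Fin m)} {w₁ : Finset (Fin n) × Finset (Fin m) × Bool} {s : Fin n}

/-! ## Small facts -/

/-- `bit` of an output value on a pure instance. -/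
private theorem bit_eval (hI : I.IsPure xorAndPred) (z : Fin n → Bool) (j : Fin m) :
    bit (I.eval z j) = bit (z (I.vars j 0)) + bit (z (I.vars j 1)) + bit (z (I.vars j 2)) * bit (z (I.vars j 3)) := by
  rw [eval_pure I hI, bit_xor, bit_xor, bit_and]

/-- A term through `s` vanishes where `x_s = 0`. -/
private theorem term_eq_zero_of_through {z : Fin n → Bool} {j : Fin m} (hj : Through I s j) (hs : z s = false) :
    bit (z (I.vars j 2)) * bit (z (I.vars j 3)) = 0 := by
  rcases hj with h | h
  · rw [h, hs]; simp [bit]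
  · rw [h, hs]; simp [bit]

/-- Decoding `𝔽₂` to `Bool`. -/
private theorem bit_decide (a : ZMod 2) : bit (decide (a = 1)) = a := by
  revert a; decide

/-- The indicator set `T ⊆ Unit` of a Boolean, and its filter-cardinality. -/
private theorem card_filter_unit (t : Bool) (P : Prop) [Decidable P] :
    (((univ : Finset Unit).filter fun _ => t = true).filter fun _ => P).card = if t = true ∧ P then 1 else 0 := by
  by_cases ht : t = true <;> by_cases hP : P <;> simp [ht, hP]

/-! ## A one-block join of value one pins its literal to one -/

/-- **A one-block join through `s` of value `1` pins `x_s ≡ 1` on the slice.**  (Sum the equations of `D` — and the reader if `t` —: the XOR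
parts cancel by the join parity, the AND terms all carry `x_s`.) -/
theorem true_of_block_join (hI : I.IsPure xorAndPred) {D : Finset (Fin m)} {t : Bool} (hD : D ⊆ K) (hJ : IsJoin I w₁.1 D t)
    (hDs : ∀ j ∈ D, Through I s j) (hGs : t = true → ∀ g ∈ w₁.2.1, Through I s g) (hval : joinValue y w₁.2.2 D t = 1)
    {z : Fin n → Bool} (hz : InSlice I y K w₁ z) : z s = true := by
  classical
  by_contra hs
  rw [Bool.not_eq_true] at hs
  set x : Fin n → ZMod 2 := fun v => bit (z v) with hx
  set T : Finset Unit := univ.filter fun _ => t = true with hT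
  -- the join parity says the summed linear form vanishes
  have hzero : (∑ j ∈ D, pairForm (fun j => I.vars j 0) (fun j => I.vars j 1) j) + (∑ _k ∈ T, setForm w₁.1) = 0 := by
    refine (sum_pairForm_add_sum_setForm_eq_zero_iff _ _ D (fun _ : Unit => w₁.1) T).2 fun w => ?_
    have := hJ w
    rwa [hT, card_filter_unit]
  have happ := congrArg (fun f : (Fin n → ZMod 2) →ₗ[ZMod 2] ZMod 2 => f x) hzero
  simp only [LinearMap.add_apply, LinearMap.coe_sum, Finset.sum_apply, pairForm_apply, setForm_apply, LinearMap.zero_apply] at happ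
  -- each output of `D`: `x u + x v = y_j` (its AND term vanishes)
  have hout : ∀ j ∈ D, x (I.vars j 0) + x (I.vars j 1) = bit (y j) := by
    intro j hj
    have := bit_eval hI z j
    rw [hz.1 j (hD hj), term_eq_zero_of_through (hDs j hj) hs, add_zero] at this
    exact this.symm
  -- the reader (if present): `Σ_{C₁} x = b₁`
  have hrd : t = true → ∑ w ∈ w₁.1, x w = bit w₁.2.2 := by
    intro ht
    have := bit_gval I w₁.1 w₁.2.1 z
    rw [hz.2, sum_eq_zero (fun g hg => term_eq_zero_of_through (hGs ht g hg) hs), add_zero] at this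
    exact this.symm
  have hv : joinValue y w₁.2.2 D t = ∑ j ∈ D, (x (I.vars j 0) + x (I.vars j 1)) + ∑ _k ∈ T, ∑ w ∈ w₁.1, x w := by
    unfold joinValue
    rw [sum_congr rfl hout]
    congr 1
    by_cases ht : t = true
    · rw [if_pos ht, hT, ← hrd ht]; simp [ht]
    · rw [if_neg ht, hT]; simp [ht]
  rw [hv, happ] at hval
  exact zero_ne_one hval

/-! ## No one-block join of value one: a point with `x_s = 0` -/

section Fredholm
open Classical in
/-- The linear form of output `j` on (XOR values, term values): `x_{u_j} + x_{v_j} + [j not through s]·u_j`. -/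
private noncomputable def outForm (I : LocalMap 4 n m) (s : Fin n) (j : Fin m) :
    ((Fin n → ZMod 2) × (Fin m → ZMod 2)) →ₗ[ZMod 2] ZMod 2 where
  toFun p := p.1 (I.vars j 0) + p.1 (I.vars j 1) + if Through I s j then 0 else p.2 j
  map_add' p q := by
    simp only [Prod.fst_add, Prod.snd_add, Pi.add_apply]
    split_ifs <;> ring
  map_smul' r p := by
    simp only [Prod.smul_fst, Prod.smul_snd, Pi.smul_apply, smul_eq_mul, RingHom.id_apply]
    split_ifs <;> ring

open Classical in
/-- The linear form of the reader `(C₁, G₁)`: `Σ_{w ∈ C₁} x_w + Σ_{g ∈ G₁ not through s} u_g`. -/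
private noncomputable def rdForm (I : LocalMap 4 n m) (s : Fin n) (C₁ : Finset (Fin n)) (G₁ : Finset (Fin m)) :
    ((Fin n → ZMod 2) × (Fin m → ZMod 2)) →ₗ[ZMod 2] ZMod 2 where
  toFun p := ∑ w ∈ C₁, p.1 w + ∑ g ∈ G₁.filter (fun g => ¬ Through I s g), p.2 g
  map_add' p q := by
    simp only [Prod.fst_add, Prod.snd_add, Pi.add_apply, sum_add_distrib]
    ring
  map_smul' r p := by
    simp only [Prod.smul_fst, Prod.smul_snd, Pi.smul_apply, smul_eq_mul, RingHom.id_apply]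
    rw [mul_add, mul_sum, mul_sum]

open Classical in
/-- Evaluation of the output form. -/
private theorem outForm_apply (I : LocalMap 4 n m) (s : Fin n) (j : Fin m) (p : (Fin n → ZMod 2) × (Fin m → ZMod 2)) :
    outForm I s j p = p.1 (I.vars j 0) + p.1 (I.vars j 1) + if Through I s j then 0 else p.2 j := rfl

open Classical in
/-- Evaluation of the reader form. -/
private theorem rdForm_apply (I : LocalMap 4 n m) (s : Fin n) (C₁ : Finset (Fin n)) (G₁ : Finset (Fin m))
    (p : (Fin n → ZMod 2) × (Fin m → ZMod 2)) :
    rdForm I s C₁ G₁ p = ∑ w ∈ C₁, p.1 w + ∑ g ∈ G₁.filter (fun g => ¬ Through I s g), p.2 g := rfl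

end Fredholm

/-- **NO ONE-BLOCK JOIN OF VALUE ONE ⇒ A POINT OF THE SLICE WITH `x_s = 0`.**  Typed pure instance; `K` and the reader's monomials `G₁` disjoint;
the reader's linear part `C₁` avoids the AND variables of `K ∪ G₁` and `s`; `s` is no XOR variable of `K`; PRIVACY: every output of `K ∪ G₁` not
through `s` has an AND variable occurring in no other AND slot of `K ∪ G₁`.  If the slice is non-empty and every one-block join through `s` has
value `0`, some point of the slice has `x_s = 0`. -/
theorem exists_false_of_no_block_join (hI : I.IsPure xorAndPred) (hT : Typed I) (hKG : Disjoint K w₁.2.1)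
    (hC₁ : ∀ v ∈ w₁.1, ∀ j ∈ K ∪ w₁.2.1, ¬ Through I v j) (hsX : ∀ j ∈ K, I.vars j 0 ≠ s ∧ I.vars j 1 ≠ s) (hsC : s ∉ w₁.1)
    (hfree : ∀ j ∈ K ∪ w₁.2.1, ¬ Through I s j → ∃ p, Through I p j ∧ ∀ j' ∈ K ∪ w₁.2.1, Through I p j' → j' = j)
    (hne : ∃ x, InSlice I y K w₁ x)
    (hno : ∀ D ⊆ K, ∀ t : Bool, IsJoin I w₁.1 D t → (∀ j ∈ D, Through I s j) → (t = true → ∀ g ∈ w₁.2.1, Through I s g) →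
      joinValue y w₁.2.2 D t ≠ 1) :
    ∃ z, InSlice I y K w₁ z ∧ z s = false := by
  classical
  obtain ⟨C₁, G₁, b₁⟩ := w₁
  simp only at hKG hC₁ hsC hfree hne hno ⊢
  set F := K ∪ G₁ with hF
  have e01 : ∀ a : ZMod 2, a ≠ 1 → a = 0 := by decide
  -- STEP 1: the linear system in (XOR values, term values) is solvable
  let L : Fin m ⊕ Unit → ((Fin n → ZMod 2) × (Fin m → ZMod 2)) →ₗ[ZMod 2] ZMod 2 :=
    fun i => Sum.elim (outForm I s) (fun _ => rdForm I s C₁ G₁) i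
  let c : Fin m ⊕ Unit → ZMod 2 := fun i => Sum.elim (fun j => bit (y j)) (fun _ => bit b₁) i
  have hsolv : ∃ p, ∀ i ∈ K.disjSum (univ : Finset Unit), L i p = c i := by
    rw [exists_solution_iff]
    intro E hE hL
    obtain ⟨D, T, rfl⟩ : ∃ D T, E = D.disjSum T := ⟨E.toLeft, E.toRight, Finset.toLeft_disjSum_toRight.symm⟩
    have hD : D ⊆ K := fun j hj => Finset.inl_mem_disjSum.1 (hE (Finset.inl_mem_disjSum.2 hj))
    rw [Finset.sum_disjSum] at hL ⊢
    -- evaluate the dependency at test vectors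
    have hev : ∀ p, ∑ j ∈ D, outForm I s j p + ∑ k ∈ T, rdForm I s C₁ G₁ p = 0 := fun p => by
      have := congrArg (fun f : ((Fin n → ZMod 2) × (Fin m → ZMod 2)) →ₗ[ZMod 2] ZMod 2 => f p) hL
      simpa only [L, Sum.elim_inl, Sum.elim_inr, LinearMap.add_apply, LinearMap.coe_sum, Finset.sum_apply, LinearMap.zero_apply]
        using this
    -- (a) `(D, t)` is a join, `t := (() ∈ T)`
    have hTsub : T = univ.filter fun _ => decide (() ∈ T) = true := by
      ext u; cases u; by_cases h : () ∈ T <;> simp [h]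
    have hjoin : IsJoin I C₁ D (decide (() ∈ T)) := by
      have hz : (∑ j ∈ D, pairForm (fun j => I.vars j 0) (fun j => I.vars j 1) j) + (∑ _k ∈ T, setForm C₁) = 0 := by
        apply LinearMap.ext; intro x
        have := hev (x, 0)
        simpa only [LinearMap.add_apply, LinearMap.coe_sum, Finset.sum_apply, pairForm_apply, setForm_apply, outForm_apply, rdForm_apply,
          Prod.fst, Prod.snd, Pi.zero_apply, ite_self, add_zero, sum_const_zero, LinearMap.zero_apply] using this
      intro w
      have := (sum_pairForm_add_sum_setForm_eq_zero_iff _ _ D (fun _ : Unit => C₁) T).1 hz w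
      rwa [hTsub, card_filter_unit] at this
    -- (b) every member of `D` passes through `s`
    have hDs : ∀ j ∈ D, Through I s j := by
      intro j hj
      by_contra hns
      have hjG : j ∉ G₁ := fun h => disjoint_left.1 hKG (hD hj) h
      have := hev (0, Pi.single j 1)
      have h1 : ∑ j' ∈ D, outForm I s j' ((0 : Fin n → ZMod 2), (Pi.single j (1 : ZMod 2) : Fin m → ZMod 2)) = 1 := by
        rw [sum_eq_single_of_mem j hj fun j' hj' hne => ?_]
        · simp [outForm_apply, hns]
        · simp [outForm_apply, hne]
      have h2 : ∑ _k ∈ T, rdForm I s C₁ G₁ ((0 : Fin n → ZMod 2), (Pi.single j (1 : ZMod 2) : Fin m → ZMod 2)) = 0 := by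
        refine sum_eq_zero fun k _ => ?_
        rw [rdForm_apply]
        simp only [Pi.zero_apply, sum_const_zero, zero_add]
        refine sum_eq_zero fun g hg => ?_
        have hne : g ≠ j := fun h => hjG (h ▸ (mem_filter.1 hg).1)
        simp [hne]
      rw [h1, h2, add_zero] at this
      exact one_ne_zero this
    -- (c) with the reader, every fold passes through `s`
    have hGs : decide (() ∈ T) = true → ∀ g ∈ G₁, Through I s g := by
      intro hT g hg
      rw [decide_eq_true_eq] at hT
      by_contra hns
      have hgK : g ∉ K := fun h => disjoint_left.1 hKG h hg
      have := hev (0, Pi.single g 1)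
      have h1 : ∑ j' ∈ D, outForm I s j' ((0 : Fin n → ZMod 2), (Pi.single g (1 : ZMod 2) : Fin m → ZMod 2)) = 0 := by
        refine sum_eq_zero fun j' hj' => ?_
        have hne : j' ≠ g := fun h => hgK (h ▸ hD hj')
        simp [outForm_apply, hne]
      have h2 : ∑ _k ∈ T, rdForm I s C₁ G₁ ((0 : Fin n → ZMod 2), (Pi.single g (1 : ZMod 2) : Fin m → ZMod 2)) = 1 := by
        have hT1 : T = {()} := by ext u; cases u; simp [hT]
        rw [hT1, sum_singleton, rdForm_apply]
        simp only [Pi.zero_apply, sum_const_zero, zero_add]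
        rw [sum_eq_single_of_mem g (mem_filter.2 ⟨hg, hns⟩) fun g' _ hne => by rw [Pi.single_apply, if_neg hne]]
        simp
      rw [h1, h2, zero_add] at this
      exact one_ne_zero this
    -- hence the right-hand sides sum to the value of a one-block join, which is `0`
    have hv := e01 _ (hno D hD _ hjoin hDs hGs)
    unfold joinValue at hv
    have hc : ∑ j ∈ D, c (Sum.inl j) + ∑ k ∈ T, c (Sum.inr k) = joinValue y b₁ D (decide (() ∈ T)) := by
      unfold joinValue
      simp only [c, Sum.elim_inl, Sum.elim_inr, sum_const]
      congr 1
      by_cases h : () ∈ T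
      · have hT1 : T = {()} := by ext u; cases u; simp [h]
        simp [hT1]
      · have hT0 : T = ∅ := by ext u; cases u; simp [h]
        simp [hT0]
    rw [hc]
    unfold joinValue
    exact hv
  obtain ⟨⟨x, u⟩, hxu⟩ := hsolv
  have hxK : ∀ j ∈ K, x (I.vars j 0) + x (I.vars j 1) + (if Through I s j then 0 else u j) = bit (y j) := fun j hj => by
    have := hxu (Sum.inl j) (Finset.inl_mem_disjSum.2 hj)
    simpa only [L, c, Sum.elim_inl, outForm_apply] using this
  have hxR : ∑ w ∈ C₁, x w + ∑ g ∈ G₁.filter (fun g => ¬ Through I s g), u g = bit b₁ := by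
    have := hxu (Sum.inr ()) (Finset.inr_mem_disjSum.2 (mem_univ _))
    simpa only [L, c, Sum.elim_inr, rdForm_apply] using this
  -- STEP 2: realise the term values through the private variables
  haveI : Nonempty (Fin n) := ⟨s⟩
  choose! pv hpv hpriv using hfree
  let z : Fin n → Bool := fun w =>
    if w = s then false
    else if h : ∃ j, j ∈ F ∧ ¬ Through I s j ∧ pv j = w then decide (u h.choose = 1)
    else if ∃ j ∈ F, Through I w j then true
    else decide (x w = 1)
  have hzs : z s = false := by simp [z]
  -- AND variables of `F` are neither XOR variables of `K` nor in `C₁` (typed; hypothesis)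
  have hand_not_xor : ∀ j ∈ F, ∀ w, Through I w j → ∀ j' ∈ K, I.vars j' 0 ≠ w ∧ I.vars j' 1 ≠ w := by
    intro j _ w hw j' _
    rcases hw with h | h
    · exact ⟨fun e => hT j' j 0 2 (by decide) (by decide) (e.trans h.symm), fun e => hT j' j 1 2 (by decide) (by decide) (e.trans h.symm)⟩
    · exact ⟨fun e => hT j' j 0 3 (by decide) (by decide) (e.trans h.symm), fun e => hT j' j 1 3 (by decide) (by decide) (e.trans h.symm)⟩
  -- the value of `z` at a variable that is no AND variable of `F` and not `s`
  have hz_free : ∀ w, w ≠ s → (∀ j ∈ F, ¬ Through I w j) → z w = decide (x w = 1) := by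
    intro w hws hno'
    have h2 : ¬ ∃ j, j ∈ F ∧ ¬ Through I s j ∧ pv j = w := by
      rintro ⟨j, hj, hns, hpj⟩
      exact hno' j hj (hpj ▸ hpv j hj hns)
    have h3 : ¬ ∃ j ∈ F, Through I w j := by
      rintro ⟨j, hj, hw⟩; exact hno' j hj hw
    simp only [z, if_neg hws, dif_neg h2, if_neg h3]
  -- the private variable of an output not through `s` carries its term value
  have hz_pv : ∀ j ∈ F, ¬ Through I s j → z (pv j) = decide (u j = 1) := by
    intro j hj hns
    have hne : pv j ≠ s := by
      rcases hpv j hj hns with h | h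
      · exact fun e => hns (Or.inl (h.trans e))
      · exact fun e => hns (Or.inr (h.trans e))
    have hex : ∃ j', j' ∈ F ∧ ¬ Through I s j' ∧ pv j' = pv j := ⟨j, hj, hns, rfl⟩
    have hch : hex.choose = j := by
      obtain ⟨hj', hns', hpj'⟩ := hex.choose_spec
      have hth := hpv _ hj' hns'
      rw [hpj'] at hth
      exact hpriv j hj hns _ hj' hth
    simp only [z, if_neg hne, dif_pos hex, hch]
  -- the other AND variable of such an output is set to `1`
  have hz_other : ∀ j ∈ F, ¬ Through I s j → ∀ w, Through I w j → w ≠ pv j → z w = true := by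
    intro j hj hns w hw hwp
    have hws : w ≠ s := by
      rcases hw with h | h
      · exact fun e => hns (Or.inl (h.trans e))
      · exact fun e => hns (Or.inr (h.trans e))
    have h2 : ¬ ∃ j', j' ∈ F ∧ ¬ Through I s j' ∧ pv j' = w := by
      rintro ⟨j', hj', hns', hpj'⟩
      have : j = j' := hpriv j' hj' hns' j hj (hpj' ▸ hw)
      subst this
      exact hwp hpj'.symm
    have h3 : ∃ j ∈ F, Through I w j := ⟨j, hj, hw⟩
    simp only [z, if_neg hws, dif_neg h2, if_pos h3]
  -- term values
  have hterm : ∀ j ∈ F, bit (z (I.vars j 2)) * bit (z (I.vars j 3)) = if Through I s j then 0 else u j := by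
    intro j hj
    by_cases hs : Through I s j
    · rw [if_pos hs]; exact term_eq_zero_of_through hs hzs
    rw [if_neg hs]
    have h23 : I.vars j 2 ≠ I.vars j 3 := fun e => absurd (hI.2 j e) (by decide)
    rcases hpv j hj hs with h | h
    · rw [h, hz_pv j hj hs, hz_other j hj hs (I.vars j 3) (Or.inr rfl) (fun e => h23 (h.trans e.symm)), bit_decide]
      simp [bit]
    · rw [h, hz_pv j hj hs, hz_other j hj hs (I.vars j 2) (Or.inl rfl) (fun e => h23 (e.trans h.symm)), bit_decide]
      simp [bit]
  -- XOR variables of `K` and the variables of `C₁` follow `x`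
  have hxor : ∀ j ∈ K, ∀ σ : Fin 4, σ = 0 ∨ σ = 1 → bit (z (I.vars j σ)) = x (I.vars j σ) := by
    intro j hj σ hσ
    have hws : I.vars j σ ≠ s := by rcases hσ with rfl | rfl; exacts [(hsX j hj).1, (hsX j hj).2]
    have hno' : ∀ j' ∈ F, ¬ Through I (I.vars j σ) j' := by
      intro j' hj' hw
      have := hand_not_xor j' hj' _ hw j hj
      rcases hσ with rfl | rfl; exacts [this.1 rfl, this.2 rfl]
    rw [hz_free _ hws hno', bit_decide]
  have hC : ∀ w ∈ C₁, bit (z w) = x w := by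
    intro w hw
    have hws : w ≠ s := fun e => hsC (e ▸ hw)
    rw [hz_free w hws (fun j hj => hC₁ w hw j hj), bit_decide]
  refine ⟨z, ⟨fun j hj => ?_, ?_⟩, hzs⟩
  · apply bit_injective
    rw [bit_eval hI, hxor j hj 0 (Or.inl rfl), hxor j hj 1 (Or.inr rfl), hterm j (mem_union_left _ hj), hxK j hj]
  · apply bit_injective
    rw [bit_gval, sum_congr rfl hC, sum_congr rfl fun g hg => hterm g (mem_union_right _ hg), ← hxR, sum_filter]
    congr 1
    exact sum_congr rfl fun g _ => by by_cases h : Through I s g <;> simp [h]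

end Summit.PneNP.PneNP.Theorems.PstarLiteralPinning
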